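import Literature.MathematicalPhysics.QuantumFieldTheory.Balaban1983to89.Node00.TransportOfRecordGaugeFixing
import Literature.MathematicalPhysics.QuantumFieldTheory.Balaban1983to89.Node00.StepWeightsOfRecord
import Summits.QuantumFields.YangMills.Theorems.BalabanUVNodesN11TransportFineGaugeOrbitAverage

/-!
# DAG node N11 — (1.5)'s FADDEEV–POPOV FACTOR INSIDE def-T's STEP WEIGHT CHANGES THE TERMS OF (†), NOT THEIR `χ_{k+1}`-WEIGHTED SUM:
# def-T's proved `IsRT` face `isRT_sum_texpASucc` SURVIVES the repair that restores print's p.265 L.8–12 order ((3.2) → (1.5)⇒(1.6) → (3.3))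

HEADER — WORK-UNIT METADATA.  Cell `pub-ymgap`, YM-PLAN Track A (HUMAN RULING D-0062), R134 fan-out seat `pub-ymgap-dag-n11-e` (g31) on node N11 [B14]; route
`BalabanUVNodes`, key K1⁹ = stmt-QuantumFields-27364 (helper, `--kind proof --supports 27364 --as helper`, count-neutral).  [I] = [Balaban1987RG1], [III] = [Balaban1988Convergent].
Third file of this seat's g31 LOCATED-FP triple (`…N11TransportFineGaugeOrbitAverage` = the orbit-average law: (†) reads a non-invariant factor only through its UNIFORM fine-gauge
orbit average; `…N11TopPairOldSideFineGaugeOrbitAverage` = the top pair + the non-invariance witness for (3.3)'s `χ′`).  Over, BY NAME and unmodified: def-T's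
`Node00/TStepOfRecord` (`texpASucc`, `IsStepUnity`, `integrable_graph_piece`, `integrable_transport_piece`, `integral_transport_piece` — and the SHAPE of its proof of
`isRT_sum_texpASucc`, replayed here with one more factor), this seat's g22 `Node00/TransportOfRecordGaugeFixing` (`integral_fpWeight_mul_mul_comp_avg_eq` = (1.5)⇒(1.6) against a
test function of the coarse field), `B12FaddeevPopov016` (`fpIntegrand`, `abs_fpIntegrand_le_one`, `measurable_fpIntegrand`), n22-b's `B14Eq218SeqSucc` (`Seq.sum_seq_succ_fiber`), def-T's
`Node00/StepWeightsOfRecord` (`wOfRecord`, `isStepUnity_wOfRecord`, `abs_wOfRecord_le_one`).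

WHY.  LOCATED-FP (evidence #48 on 27364, `HOME/pub-ymgap-dag-n11-e/N11-LOCATED-FP-g31.md`): print inserts (3.3) under the Faddeev–Popov gauge-fixed integral (1.6); def-T's (†)
integrand `w(s′)(U,V′)·χ_k·T_k` carries no FP factor, and the orbit-average law shows the TERMS then differ from print's (uniform vs FP-weighted fine-gauge orbit average of the weight).
Repair option (R1) puts [I] (0.16)'s factor `fpW(U) = Π_{y∈Y}Π_{x∈B(y)∖y}(1∕z)χ(|U(y,x)−1|<ε₀)e^{−(1−Re tr U(y,x))∕α}` INTO the step weight.  The new weight `fpW·w` is bounded (by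
`Π|z|⁻¹`, not by `1`) and resolves unity only AFTER the fine-gauge orbit integral — so def-T's FILE 1 theorem `isRT_sum_texpASucc` (stated for `|w| ≤ 1` and POINTWISE unity) does
not literally apply.  THIS FILE proves that its CONCLUSION still holds: the assembled level-(k+1) density with the FP-weighted step weights is an `IsRT`-image of `Σ_s χ_k(s)·T(s)`,
because after the fibrewise resummation (pointwise unity of `w`) what is left under `dU` is `fpW·ρ_k·f(Ū)` with `ρ_k = Σ_sχ_k(s)T(s)` fine-gauge INVARIANT, and (1.5)⇒(1.6) removes `fpW`
there.  So (R1) changes every term of (†) and none of its sums.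

WHAT THIS FILE PROVES (0 `def`, 0 `sorry`, standard axioms; `fpW` SPELLED OUT as the double product).
§1 generic (`Seq D k` over a finite label alphabet; `RegularGaugeGroup` with Haar data, standard Borel, standing range `k + 1 ≤ m + K`; `Ū` measurable, `HaarAC`, invariant under the
   fine gauge group; any contour data with measurable `U ↦ U(y,x)`, `α > 0`, `z ≠ 0`, any finset `Y` of centres; weights jointly measurable with `|w| ≤ C_w` and def-T's POINTWISE
   `IsStepUnity`; new front factors measurable with `|χ_{k+1}| ≤ 1`; old pieces `χ_k(s)·T(s)` integrable with `Σ_s χ_k(s)T(s)` fine-gauge invariant):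
   `measurable_fpW` · `abs_fpW_le` · ★★★ `isRT_sum_texpASucc_fpWeight_mul` · `integrable_piece_texpASucc_fpWeight_mul` (the new pieces stay integrable, so the step iterates).
§2 at def-T's step weights OF RECORD (`SU(N)`, run `p`, couplings `g`, `k < p.K`, `cd := contourOfRecord`, `ε₀ > 0`; `isStepUnity_wOfRecord` ∕ `abs_wOfRecord_le_one` BY NAME under the
   displayed ζ-laws; displayed: joint measurability of `w` (def-T's (O4)), of the front factors, and the fine-gauge invariance + integrability of the level-k density):
   ★★★ `isRT_sum_tstep_fpWeight_mul` (any weights with def-T's unity law) · ★★★ `isRT_sum_tstep_fpWeight_mul_wOfRecord` · ★★★ `isRT_sum_tstep_fpWeight_mul_wOfRecord_zero` (the first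
   step `k = 0`: slot `ρ₀`, `χ_0 ≡ 1` — the invariance row DISCHARGED, nothing of print hypothesised).

HONEST FRAMING.  Helper lane of K1⁹, count-neutral; a repair OPTION made checkable, NOT adopted (the type owner node00-def-T decides where (1.5) enters (†)); nothing of Bałaban's
ESTIMATES asserted; Thm 1 ∕ Thm 2 ∕ (O3′) NOT touched; N11 NOT discharged; K1⁹ NOT closed; counts unmoved (typed 28∕28 · discharged 5∕27).  One finite four-torus programme at fixed
`ε = L^{−K}` — NOT ℝ⁴, NOT OS, NOT a mass gap, NOT Clay.  No `sorry`, `axiom`, `def`, `instance`, `notation`.  Sources (SHAPE ∕ bookkeeping only): [III] (1.5)–(1.6) p.247, (3.1) p.264,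
(3.3) p.265 L.8–12, (3.24)–(3.25) p.270; [I] (0.13)–(0.16) pp.254–255, (0.19) p.255.
-/

noncomputable section

open MeasureTheory Function
open scoped ENNReal BigOperators

namespace Summit.QuantumFields.YangMills.Theorems.BalabanUVNodesN11TStepFaddeevPopovWeightSum

open Literature.MathematicalPhysics.QuantumFieldTheory.Balaban1983to89
open GaugeField (gaugeAct)
open T4AveragingDisintegration (kernelTransport transportK avgDensity avgKernel)
open T4FiniteEpsInhabited (HaarAC)
open B12FaddeevPopov016 (FineGauge FineGaugeInvariant fpIntegrand abs_fpIntegrand_le_one measurable_fpIntegrand)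
open B14.Eq218Concrete (Seq)
open Node00 (texpASucc tstepIntegrand IsStepUnity texpASucc_apply integrable_graph_piece integrable_transport_piece integral_transport_piece
  integral_fpWeight_mul_mul_comp_avg_eq)

/-! ## §1  Generic: the FP-weighted step keeps def-T's `IsRT` face -/

section Generic

variable {P : Params} {G : Type*} [GaugeGroup G] [MeasurableSpace G] [HaarData G] [RegularGaugeGroup G]
variable {α : Type*} {D : ℕ → Set (Set α)} {k : ℕ}

omit [HaarData G] in
/-- The (1.6) product `fpW(U) = Π_{y∈Y}Π_{x∈B(y)∖y}(1∕z)·χ e^{−(1∕α)[1−Re tr U(y,x)]}` is measurable in `U` (measurable contour variables). [cite: Balaban1988Convergent, (1.6) p.247] -/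
theorem measurable_fpW (cd : ContourData P k G) (hcd : ∀ (y : Site P (k + 1)) (x : Site P k), Measurable fun U : GaugeField P k G => cd.holTo U y x)
    (a ε₀ z : ℝ) (Y : Finset (Site P (k + 1))) :
    Measurable fun U : GaugeField P k G => ∏ y ∈ Y, ∏ x ∈ (block y).erase (emb y), z⁻¹ * fpIntegrand a ε₀ (cd.holTo U y x) := by
  refine Finset.measurable_prod _ fun y _ => Finset.measurable_prod _ fun x _ => ?_
  exact (measurable_const.mul (measurable_fpIntegrand a ε₀)).comp (hcd y x)

omit [MeasurableSpace G] [HaarData G] [RegularGaugeGroup G] in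
/-- … and bounded by `Π_{y∈Y}Π_{x∈B(y)∖y}|z|⁻¹` (`|χe^{−…}| ≤ 1`, `α > 0`). [cite: Balaban1988Convergent, (1.6) p.247] -/
theorem abs_fpW_le (cd : ContourData P k G) {a : ℝ} (ha : 0 < a) (ε₀ z : ℝ) (Y : Finset (Site P (k + 1))) (U : GaugeField P k G) :
    |∏ y ∈ Y, ∏ x ∈ (block y).erase (emb y), z⁻¹ * fpIntegrand a ε₀ (cd.holTo U y x)| ≤ ∏ y ∈ Y, ∏ _x ∈ (block y).erase (emb y), |z|⁻¹ := by
  rw [Finset.abs_prod]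
  refine Finset.prod_le_prod (fun y _ => abs_nonneg _) fun y _ => ?_
  rw [Finset.abs_prod]
  refine Finset.prod_le_prod (fun x _ => abs_nonneg _) fun x _ => ?_
  rw [abs_mul, abs_inv]
  calc |z|⁻¹ * |fpIntegrand a ε₀ (cd.holTo U y x)|
      ≤ |z|⁻¹ * 1 := mul_le_mul_of_nonneg_left (abs_fpIntegrand_le_one ha ε₀ _) (inv_nonneg.2 (abs_nonneg z))
    _ = |z|⁻¹ := mul_one _

variable [StandardBorelSpace G]

/-- ★★★ **THE FADDEEV–POPOV FACTOR INSIDE THE STEP WEIGHT DOES NOT MOVE THE SUM OF THE TERMS OF (†).**  For def-T's value-level T-step `texpASucc` along an averaging `Ū`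
(measurable, `HaarAC`, fine-gauge invariant), old pieces `χ_k(s)·T(s)` (integrable, with `ρ_k := Σ_s χ_k(s)T(s)` FINE-GAUGE INVARIANT), new front factors `χ_{k+1}(s′)` (measurable,
`|·| ≤ 1`) and step weights `w(s′)(U,V′)` (jointly measurable, `|·| ≤ C_w`, resolving unity POINTWISE on the graph: def-T's `IsStepUnity`), and for (1.6)'s product `fpW` on any finset
`Y` of centres (`α > 0`, `z ≠ 0`, measurable contour variables): the assembled density `V′ ↦ Σ_{s′} χ_{k+1}(s′)(V′)·∫dU δ(ŪV′⁻¹)[fpW(U)·w(s′)(U,V′)·χ_k·T_k]` IS an `IsRT`-image of `ρ_k`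
along `Ū` — def-T's `isRT_sum_texpASucc` computation with `fpW` carried through the fibrewise resummation, then removed on `fpW·ρ_k·f(Ū)` by (1.5)⇒(1.6)
(`integral_fpWeight_mul_mul_comp_avg_eq`). [cite: Balaban1988Convergent, (1.5)–(1.6) p.247, (3.1) p.264, p.265 L.8–12, (3.25) p.270; Balaban1987RG1, (0.16) p.255] -/
theorem isRT_sum_texpASucc_fpWeight_mul [Finite α] (hk : k + 1 ≤ P.m + P.K) (cd : ContourData P k G)
    (hcd : ∀ (y : Site P (k + 1)) (x : Site P k), Measurable fun U : GaugeField P k G => cd.holTo U y x)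
    {a ε₀ : ℝ} (ha : 0 < a) (hz : B16ZLower.zNorm G a ε₀ ≠ 0) (Y : Finset (Site P (k + 1)))
    {avg : GaugeField P k G → GaugeField P (k + 1) G} (havg : Measurable avg) (hac : HaarAC avg)
    (havgInv : ∀ u : GaugeTransf P k G, FineGauge u → ∀ U, avg (gaugeAct u U) = avg U)
    (χk T : Seq D k → Density P k G) (χk1 : Seq D (k + 1) → Density P (k + 1) G)
    (w : Seq D (k + 1) → GaugeField P k G → GaugeField P (k + 1) G → ℝ)
    (hT : ∀ s, Integrable (fun U => χk s U * T s U) (fieldMeasure P k G)) (hinv : FineGaugeInvariant (fun U => ∑ s, χk s U * T s U))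
    (hw : ∀ s', Measurable (fun z : GaugeField P (k + 1) G × GaugeField P k G => w s' z.2 z.1)) {Cw : ℝ} (hwb : ∀ s' U V', |w s' U V'| ≤ Cw)
    (hχ : ∀ s', Measurable (χk1 s')) (hχb : ∀ s' V', |χk1 s' V'| ≤ 1) (hunit : IsStepUnity avg χk χk1 w) :
    IsRT avg (fun U => ∑ s, χk s U * T s U)
      (fun V' => ∑ s', χk1 s' V' *
        texpASucc avg χk T (fun s U V => (∏ y ∈ Y, ∏ x ∈ (block y).erase (emb y), (B16ZLower.zNorm G a ε₀)⁻¹ * fpIntegrand a ε₀ (cd.holTo U y x)) * w s U V) s' V') := by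
  classical
  intro f hf hfC
  obtain ⟨C, hC⟩ := hfC
  set z : ℝ := B16ZLower.zNorm G a ε₀ with hzdef
  set CF : ℝ := ∏ y ∈ Y, ∏ _x ∈ (block y).erase (emb y), |z|⁻¹ with hCF
  have hFm : Measurable fun U : GaugeField P k G => ∏ y ∈ Y, ∏ x ∈ (block y).erase (emb y), z⁻¹ * fpIntegrand a ε₀ (cd.holTo U y x) :=
    measurable_fpW cd hcd a ε₀ z Y
  -- the cofactor of one piece: `fpW(U)·w(s′)(U,V)·χ_{k+1}(s′)(V)·f(V)`, bounded and jointly measurable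
  have hb : ∀ s', Measurable (fun q : GaugeField P (k + 1) G × GaugeField P k G =>
      (∏ y ∈ Y, ∏ x ∈ (block y).erase (emb y), z⁻¹ * fpIntegrand a ε₀ (cd.holTo q.2 y x)) * w s' q.2 q.1 * (χk1 s' q.1 * f q.1)) :=
    fun s' => ((hFm.comp measurable_snd).mul (hw s')).mul (((hχ s').comp measurable_fst).mul (hf.comp measurable_fst))
  have hbC : ∀ s' (q : GaugeField P (k + 1) G × GaugeField P k G),
      ‖(∏ y ∈ Y, ∏ x ∈ (block y).erase (emb y), z⁻¹ * fpIntegrand a ε₀ (cd.holTo q.2 y x)) * w s' q.2 q.1 * (χk1 s' q.1 * f q.1)‖ ≤ CF * Cw * C := by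
    intro s' q
    have hCw0 : 0 ≤ Cw := le_trans (abs_nonneg _) (hwb s' q.2 q.1)
    rw [Real.norm_eq_abs, abs_mul, abs_mul, abs_mul]
    have h1 := abs_fpW_le cd ha ε₀ z Y q.2
    calc |∏ y ∈ Y, ∏ x ∈ (block y).erase (emb y), z⁻¹ * fpIntegrand a ε₀ (cd.holTo q.2 y x)| * |w s' q.2 q.1| * (|χk1 s' q.1| * |f q.1|)
        ≤ CF * Cw * (1 * C) :=
          mul_le_mul (mul_le_mul h1 (hwb _ _ _) (abs_nonneg _) (le_trans (abs_nonneg _) h1))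
            (mul_le_mul (hχb _ _) (hC _) (abs_nonneg _) zero_le_one) (mul_nonneg (abs_nonneg _) (abs_nonneg _))
            (mul_nonneg (le_trans (abs_nonneg _) h1) hCw0)
      _ = CF * Cw * C := by ring
  have e : ∀ s' V, χk1 s' V *
      texpASucc avg χk T (fun s U V => (∏ y ∈ Y, ∏ x ∈ (block y).erase (emb y), z⁻¹ * fpIntegrand a ε₀ (cd.holTo U y x)) * w s U V) s' V * f V =
      (avgDensity avg V : ℝ) * ∫ U, (χk s'.init U * T s'.init U) *
        ((∏ y ∈ Y, ∏ x ∈ (block y).erase (emb y), z⁻¹ * fpIntegrand a ε₀ (cd.holTo U y x)) * w s' U V * (χk1 s' V * f V)) ∂(avgKernel avg V) := by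
    intro s' V
    have : ∫ U, (χk s'.init U * T s'.init U) *
        ((∏ y ∈ Y, ∏ x ∈ (block y).erase (emb y), z⁻¹ * fpIntegrand a ε₀ (cd.holTo U y x)) * w s' U V * (χk1 s' V * f V)) ∂(avgKernel avg V)
        = (∫ U, (∏ y ∈ Y, ∏ x ∈ (block y).erase (emb y), z⁻¹ * fpIntegrand a ε₀ (cd.holTo U y x)) * w s' U V *
            (χk s'.init U * T s'.init U) ∂(avgKernel avg V)) * (χk1 s' V * f V) := by
      rw [← integral_mul_const]
      refine integral_congr_ae (ae_of_all _ fun U => ?_)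
      ring
    rw [this, texpASucc_apply]
    ring
  have step1 : ∀ V, (∑ s', χk1 s' V *
      texpASucc avg χk T (fun s U V => (∏ y ∈ Y, ∏ x ∈ (block y).erase (emb y), z⁻¹ * fpIntegrand a ε₀ (cd.holTo U y x)) * w s U V) s' V) * f V =
      ∑ s', (avgDensity avg V : ℝ) * ∫ U, (χk s'.init U * T s'.init U) *
        ((∏ y ∈ Y, ∏ x ∈ (block y).erase (emb y), z⁻¹ * fpIntegrand a ε₀ (cd.holTo U y x)) * w s' U V * (χk1 s' V * f V)) ∂(avgKernel avg V) := by
    intro V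
    rw [Finset.sum_mul]
    exact Finset.sum_congr rfl fun s' _ => e s' V
  -- fibrewise resummation under `dU`: the pointwise unity of `w` leaves `fpW·ρ_k·f(Ū)`
  have step2 : ∀ U, ∑ s', (χk s'.init U * T s'.init U) *
      ((∏ y ∈ Y, ∏ x ∈ (block y).erase (emb y), z⁻¹ * fpIntegrand a ε₀ (cd.holTo U y x)) * w s' U (avg U) * (χk1 s' (avg U) * f (avg U))) =
      ((∏ y ∈ Y, ∏ x ∈ (block y).erase (emb y), z⁻¹ * fpIntegrand a ε₀ (cd.holTo U y x)) * ∑ s, χk s U * T s U) * f (avg U) := by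
    intro U
    rw [Seq.sum_seq_succ_fiber, Finset.mul_sum, Finset.sum_mul]
    refine Finset.sum_congr rfl fun s _ => ?_
    have hu := hunit s U
    calc ∑ s' ∈ Finset.univ.filter (fun s' : Seq D (k + 1) => s'.init = s),
          (χk s'.init U * T s'.init U) *
            ((∏ y ∈ Y, ∏ x ∈ (block y).erase (emb y), z⁻¹ * fpIntegrand a ε₀ (cd.holTo U y x)) * w s' U (avg U) * (χk1 s' (avg U) * f (avg U)))
        = ∑ s' ∈ Finset.univ.filter (fun s' : Seq D (k + 1) => s'.init = s),
            ((∏ y ∈ Y, ∏ x ∈ (block y).erase (emb y), z⁻¹ * fpIntegrand a ε₀ (cd.holTo U y x)) * T s U * f (avg U)) *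
              (χk s U * (χk1 s' (avg U) * w s' U (avg U))) := by
          refine Finset.sum_congr rfl fun s' hs' => ?_
          rw [(Finset.mem_filter.1 hs').2]
          ring
      _ = (∏ y ∈ Y, ∏ x ∈ (block y).erase (emb y), z⁻¹ * fpIntegrand a ε₀ (cd.holTo U y x)) * (χk s U * T s U) * f (avg U) := by
          rw [← Finset.mul_sum, ← Finset.mul_sum, hu]; ring
  -- `ρ_k` is integrable (finite sum of integrable pieces)
  have hρi : Integrable (fun U => ∑ s, χk s U * T s U) (fieldMeasure P k G) := integrable_finsetSum _ fun s _ => hT s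
  calc ∫ V, (∑ s', χk1 s' V *
        texpASucc avg χk T (fun s U V => (∏ y ∈ Y, ∏ x ∈ (block y).erase (emb y), z⁻¹ * fpIntegrand a ε₀ (cd.holTo U y x)) * w s U V) s' V) * f V
          ∂(fieldMeasure P (k + 1) G)
      = ∫ V, ∑ s', (avgDensity avg V : ℝ) * ∫ U, (χk s'.init U * T s'.init U) *
          ((∏ y ∈ Y, ∏ x ∈ (block y).erase (emb y), z⁻¹ * fpIntegrand a ε₀ (cd.holTo U y x)) * w s' U V * (χk1 s' V * f V)) ∂(avgKernel avg V)
            ∂(fieldMeasure P (k + 1) G) := integral_congr_ae (ae_of_all _ step1)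
    _ = ∑ s', ∫ V, (avgDensity avg V : ℝ) * ∫ U, (χk s'.init U * T s'.init U) *
          ((∏ y ∈ Y, ∏ x ∈ (block y).erase (emb y), z⁻¹ * fpIntegrand a ε₀ (cd.holTo U y x)) * w s' U V * (χk1 s' V * f V)) ∂(avgKernel avg V)
            ∂(fieldMeasure P (k + 1) G) :=
        integral_finsetSum _ fun s' _ => integrable_transport_piece havg hac (hT s'.init) (hb s') (hbC s')
    _ = ∑ s', ∫ U, (χk s'.init U * T s'.init U) *
          ((∏ y ∈ Y, ∏ x ∈ (block y).erase (emb y), z⁻¹ * fpIntegrand a ε₀ (cd.holTo U y x)) * w s' U (avg U) * (χk1 s' (avg U) * f (avg U)))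
            ∂(fieldMeasure P k G) :=
        Finset.sum_congr rfl fun s' _ => integral_transport_piece havg hac (hT s'.init) (hb s') (hbC s')
    _ = ∫ U, ∑ s', (χk s'.init U * T s'.init U) *
          ((∏ y ∈ Y, ∏ x ∈ (block y).erase (emb y), z⁻¹ * fpIntegrand a ε₀ (cd.holTo U y x)) * w s' U (avg U) * (χk1 s' (avg U) * f (avg U)))
            ∂(fieldMeasure P k G) :=
        (integral_finsetSum _ fun s' _ => integrable_graph_piece havg (hT s'.init) (hb s') (hbC s')).symm
    _ = ∫ U, ((∏ y ∈ Y, ∏ x ∈ (block y).erase (emb y), z⁻¹ * fpIntegrand a ε₀ (cd.holTo U y x)) * ∑ s, χk s U * T s U) * f (avg U)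
          ∂(fieldMeasure P k G) := integral_congr_ae (ae_of_all _ step2)
    _ = ∫ U, (∑ s, χk s U * T s U) * f (avg U) ∂(fieldMeasure P k G) :=
        (integral_fpWeight_mul_mul_comp_avg_eq hk cd hcd ha hz Y havg havgInv hinv hρi hf hC).symm

/-- The FP-weighted new pieces `χ_{k+1}(s′)·texpASucc(fpW·w)(s′)` are integrable (so the repaired step iterates). [cite: Balaban1988Convergent, (3.25) p.270 (bookkeeping)] -/
theorem integrable_piece_texpASucc_fpWeight_mul (cd : ContourData P k G)
    (hcd : ∀ (y : Site P (k + 1)) (x : Site P k), Measurable fun U : GaugeField P k G => cd.holTo U y x)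
    {a : ℝ} (ha : 0 < a) (ε₀ : ℝ) (Y : Finset (Site P (k + 1)))
    {avg : GaugeField P k G → GaugeField P (k + 1) G} (havg : Measurable avg) (hac : HaarAC avg)
    (χk T : Seq D k → Density P k G) (χk1 : Seq D (k + 1) → Density P (k + 1) G)
    (w : Seq D (k + 1) → GaugeField P k G → GaugeField P (k + 1) G → ℝ) (s' : Seq D (k + 1))
    (hT : Integrable (fun U => χk s'.init U * T s'.init U) (fieldMeasure P k G))
    (hw : Measurable (fun z : GaugeField P (k + 1) G × GaugeField P k G => w s' z.2 z.1)) {Cw : ℝ} (hwb : ∀ U V', |w s' U V'| ≤ Cw)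
    (hχ : Measurable (χk1 s')) (hχb : ∀ V', |χk1 s' V'| ≤ 1) :
    Integrable (fun V' => χk1 s' V' *
      texpASucc avg χk T (fun s U V => (∏ y ∈ Y, ∏ x ∈ (block y).erase (emb y), (B16ZLower.zNorm G a ε₀)⁻¹ * fpIntegrand a ε₀ (cd.holTo U y x)) * w s U V) s' V')
      (fieldMeasure P (k + 1) G) := by
  set z : ℝ := B16ZLower.zNorm G a ε₀ with hzdef
  have hCw0 : 0 ≤ Cw := le_trans (abs_nonneg _) (hwb 1 1)
  have hFm : Measurable fun U : GaugeField P k G => ∏ y ∈ Y, ∏ x ∈ (block y).erase (emb y), z⁻¹ * fpIntegrand a ε₀ (cd.holTo U y x) :=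
    measurable_fpW cd hcd a ε₀ z Y
  have hb : Measurable (fun q : GaugeField P (k + 1) G × GaugeField P k G =>
      (∏ y ∈ Y, ∏ x ∈ (block y).erase (emb y), z⁻¹ * fpIntegrand a ε₀ (cd.holTo q.2 y x)) * w s' q.2 q.1 * χk1 s' q.1) :=
    ((hFm.comp measurable_snd).mul hw).mul (hχ.comp measurable_fst)
  have hbC : ∀ q : GaugeField P (k + 1) G × GaugeField P k G,
      ‖(∏ y ∈ Y, ∏ x ∈ (block y).erase (emb y), z⁻¹ * fpIntegrand a ε₀ (cd.holTo q.2 y x)) * w s' q.2 q.1 * χk1 s' q.1‖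
        ≤ (∏ y ∈ Y, ∏ _x ∈ (block y).erase (emb y), |z|⁻¹) * Cw * 1 := by
    intro q
    rw [Real.norm_eq_abs, abs_mul, abs_mul]
    have h1 := abs_fpW_le cd ha ε₀ z Y q.2
    exact mul_le_mul (mul_le_mul h1 (hwb _ _) (abs_nonneg _) (le_trans (abs_nonneg _) h1)) (hχb _) (abs_nonneg _)
      (mul_nonneg (le_trans (abs_nonneg _) h1) hCw0)
  refine (integrable_transport_piece havg hac hT hb hbC).congr (ae_of_all _ fun V => ?_)
  have : ∫ U, (χk s'.init U * T s'.init U) *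
      ((∏ y ∈ Y, ∏ x ∈ (block y).erase (emb y), z⁻¹ * fpIntegrand a ε₀ (cd.holTo U y x)) * w s' U V * χk1 s' V) ∂(avgKernel avg V)
      = (∫ U, (∏ y ∈ Y, ∏ x ∈ (block y).erase (emb y), z⁻¹ * fpIntegrand a ε₀ (cd.holTo U y x)) * w s' U V *
          (χk s'.init U * T s'.init U) ∂(avgKernel avg V)) * χk1 s' V := by
    rw [← integral_mul_const]
    refine integral_congr_ae (ae_of_all _ fun U => ?_)
    ring
  show (avgDensity avg V : ℝ) * ∫ U, (χk s'.init U * T s'.init U) *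
      ((∏ y ∈ Y, ∏ x ∈ (block y).erase (emb y), z⁻¹ * fpIntegrand a ε₀ (cd.holTo U y x)) * w s' U V * χk1 s' V) ∂(avgKernel avg V)
    = χk1 s' V * texpASucc avg χk T (fun s U V => (∏ y ∈ Y, ∏ x ∈ (block y).erase (emb y), z⁻¹ * fpIntegrand a ε₀ (cd.holTo U y x)) * w s U V) s' V
  rw [this, texpASucc_apply]
  ring

end Generic

/-! ## §2  At def-T's step OF RECORD (`SU(N)`, `avOfRecord`, `contourOfRecord`, `k < K`) -/

section Record

open T4Continuum (T4Family)
open Node00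

variable (F : T4Family) (N : ℕ) [NeZero N]

/-- The standing range `k + 1 ≤ m + K` of the `K`-th torus from `k < K` (bookkeeping). [folklore] -/
private theorem succ_le_m_add_K_of_lt {K k : ℕ} (hk : k < K) : k + 1 ≤ (F.P K).m + (F.P K).K := by
  simp only [T4Family.P_K, T4Family.P_m]; omega

/-- ★★★ **AT THE RECORD, ANY STEP WEIGHTS WITH def-T's UNITY LAW**: for a run `p`, couplings `g`, `k < p.K`, step weights `w` (jointly measurable, `|w p g k ·| ≤ C_w`, def-T's
`IsStepUnity` along `avOfRecord`), slots `T` with integrable pieces and a FINE-GAUGE-INVARIANT level-k density `Σ_s χ_k(s)·T(s)`, measurable new front factors, `α > 0`, `ε₀ > 0`, any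
finset `Y` of centres of `T^{(k+1)}`: the FP-WEIGHTED T-step's assembled density is an `IsRT`-image of the level-k density along `avOfRecord` — the conclusion of def-T's
`isRT_tstepOfRecord`, for the weight `fpW·w` that is neither bounded by `1` nor a pointwise partition of unity. [cite: Balaban1988Convergent, (1.5)–(1.6) p.247, (3.1) p.264, p.265 L.8–12, (3.25) p.270] -/
theorem isRT_sum_tstep_fpWeight_mul (ν : Stage7Numerics) (M : ℕ) (w : StepWeightsOfRecord F N ν M) (p : B12.RunParams) (g : ℕ → ℝ) {k : ℕ}
    (hk : k < p.K) {a ε₀ : ℝ} (ha : 0 < a) (hε : 0 < ε₀) (Y : Finset (Site (F.P p.K) (k + 1)))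
    (T : SeqOfRecord F ν M g p.K k → Density (F.P p.K) k (SU N))
    (hT : ∀ s, Integrable (fun U => chiSeqOfRecord F N ν M g p.K k s U * T s U) (fieldMeasure (F.P p.K) k (SU N)))
    (hinv : FineGaugeInvariant (fun U => ∑ s, chiSeqOfRecord F N ν M g p.K k s U * T s U))
    (hw : ∀ s', Measurable (fun z : GaugeField (F.P p.K) (k + 1) (SU N) × GaugeField (F.P p.K) k (SU N) => w p g k s' z.2 z.1))
    {Cw : ℝ} (hwb : ∀ s' U V', |w p g k s' U V'| ≤ Cw) (hχ : ∀ s', Measurable (chiSeqOfRecord F N ν M g p.K (k + 1) s'))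
    (hunit : IsStepUnity (avOfRecord F N p.K k).avg (chiSeqOfRecord F N ν M g p.K k) (chiSeqOfRecord F N ν M g p.K (k + 1)) (w p g k)) :
    IsRT (avOfRecord F N p.K k).avg (fun U => ∑ s, chiSeqOfRecord F N ν M g p.K k s U * T s U)
      (fun V' => ∑ s', chiSeqOfRecord F N ν M g p.K (k + 1) s' V' *
        texpASucc (avOfRecord F N p.K k).avg (chiSeqOfRecord F N ν M g p.K k) T
          (fun s U V => (∏ y ∈ Y, ∏ x ∈ (block y).erase (emb y),
            (B16ZLower.zNorm (SU N) a ε₀)⁻¹ * fpIntegrand a ε₀ ((contourOfRecord F N p.K k).holTo U y x)) * w p g k s U V) s' V') :=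
  isRT_sum_texpASucc_fpWeight_mul (succ_le_m_add_K_of_lt F hk) (contourOfRecord F N p.K k) (measurable_holTo_contourOfRecord F N p.K k) ha
    (B12FaddeevPopov016TwoLevel.zNorm_specialUnitaryGroup_pos ha hε).ne' Y (avOfRecord_measurable F N p.K k) (avOfRecord_haarAC F N p.K k hk)
    (fun _ hu U => avOfRecord_gaugeAct_of_fineGauge F N hk hu U) _ T _ _ hT hinv hw hwb hχ
    (fun s' V' => abs_chiSeqOfRecord_le_one F N ν M g p.K (k + 1) s' V') hunit

/-- ★★★ **AT def-T's STEP WEIGHTS OF RECORD `wOfRecord A₁ ζ`** (unity `isStepUnity_wOfRecord` and `|w| ≤ 1` `abs_wOfRecord_le_one` BY NAME from the displayed ζ-laws; displayed: the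
joint measurability of `w` — def-T's (O4) —, of the new front factors, and the fine-gauge invariance + integrability of the level-k density): the assembled density of the
FP-WEIGHTED T-step `Σ_{s′} χ_{k+1}(s′)·∫dU δ(ŪV′⁻¹)[fpW·w(s′)·χ_k·T_k]` is an `IsRT`-image of `Σ_s χ_k(s)·T(s)` along `avOfRecord` — repair option (R1) keeps the T-step an RT.
[cite: Balaban1988Convergent, (1.5)–(1.6) p.247, (3.1) p.264, p.265 L.8–12, §3 p.267, (3.25) p.270] -/
theorem isRT_sum_tstep_fpWeight_mul_wOfRecord (ν : Stage7Numerics) (M : ℕ) (A₁ : ℝ) {ζ : ZetaOfRecord F N ν M}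
    (hζ : IsZetaUnity F N ν M ζ) (hζ' : IsZetaAbsLeOne F N ν M ζ) (p : B12.RunParams) (g : ℕ → ℝ) {k : ℕ} (hk : k < p.K)
    {a ε₀ : ℝ} (ha : 0 < a) (hε : 0 < ε₀) (Y : Finset (Site (F.P p.K) (k + 1)))
    (T : SeqOfRecord F ν M g p.K k → Density (F.P p.K) k (SU N))
    (hT : ∀ s, Integrable (fun U => chiSeqOfRecord F N ν M g p.K k s U * T s U) (fieldMeasure (F.P p.K) k (SU N)))
    (hinv : FineGaugeInvariant (fun U => ∑ s, chiSeqOfRecord F N ν M g p.K k s U * T s U))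
    (hw : ∀ s', Measurable
      (fun z : GaugeField (F.P p.K) (k + 1) (SU N) × GaugeField (F.P p.K) k (SU N) => wOfRecord F N ν M A₁ ζ p g k s' z.2 z.1))
    (hχ : ∀ s', Measurable (chiSeqOfRecord F N ν M g p.K (k + 1) s')) :
    IsRT (avOfRecord F N p.K k).avg (fun U => ∑ s, chiSeqOfRecord F N ν M g p.K k s U * T s U)
      (fun V' => ∑ s', chiSeqOfRecord F N ν M g p.K (k + 1) s' V' *
        texpASucc (avOfRecord F N p.K k).avg (chiSeqOfRecord F N ν M g p.K k) T
          (fun s U V => (∏ y ∈ Y, ∏ x ∈ (block y).erase (emb y),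
            (B16ZLower.zNorm (SU N) a ε₀)⁻¹ * fpIntegrand a ε₀ ((contourOfRecord F N p.K k).holTo U y x)) * wOfRecord F N ν M A₁ ζ p g k s U V) s' V') :=
  isRT_sum_tstep_fpWeight_mul F N ν M (wOfRecord F N ν M A₁ ζ) p g hk ha hε Y T hT hinv hw
    (fun s' U V' => abs_wOfRecord_le_one F N ν M A₁ hζ' p g k s' U V') hχ (isStepUnity_wOfRecord F N ν M A₁ hζ p g k)

/-- ★★★ **THE FIRST STEP `k = 0`, NO DISPLAYED INVARIANCE ROW**: at level 0 the slot is `ρ₀ = e^{−E}e^{−A∕g₀²}` (def-T `texpAOfRecord_zero`, by `rfl`) and `χ_0 ≡ 1` (`chiSeqOfRecord_zero`), so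
the level-0 density `Σ_s χ_0(s)·ρ₀ = ρ₀` (one term, `Seq.sum_seq_zero`) IS fine-gauge invariant (`fineGaugeInvariant_rhoZeroOfRecord`) and integrable: for `0 < K`, `α > 0`, `ε₀ > 0`,
any finset `Y` of centres of `T^{(1)}`, and def-T's `wOfRecord A₁ ζ` under its two ζ-laws (displayed: joint measurability of `w`, measurability of `χ_1`), the assembled density of the
FP-WEIGHTED first T-step is an `IsRT`-image of `ρ₀` along `avOfRecord … 0` — (R1) at [III] Thm 1's first step ∕ [I] (0.16)–(0.19), with NOTHING of print hypothesised.
[cite: Balaban1988Convergent, Thm 1 p.262, (1.5)–(1.6) p.247, (3.1) p.264, p.265 L.8–12; Balaban1987RG1, (0.16)–(0.19) p.255] -/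
theorem isRT_sum_tstep_fpWeight_mul_wOfRecord_zero (ν : Stage7Numerics) (M : ℕ) (A₁ : ℝ) {ζ : ZetaOfRecord F N ν M}
    (hζ : IsZetaUnity F N ν M ζ) (hζ' : IsZetaAbsLeOne F N ν M ζ) (p : B12.RunParams) (g : ℕ → ℝ) (hK : 0 < p.K)
    {a ε₀ : ℝ} (ha : 0 < a) (hε : 0 < ε₀) (Y : Finset (Site (F.P p.K) 1)) (E : ℝ)
    (hw : ∀ s', Measurable
      (fun z : GaugeField (F.P p.K) 1 (SU N) × GaugeField (F.P p.K) 0 (SU N) => wOfRecord F N ν M A₁ ζ p g 0 s' z.2 z.1))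
    (hχ : ∀ s', Measurable (chiSeqOfRecord F N ν M g p.K 1 s')) :
    IsRT (avOfRecord F N p.K 0).avg (rhoZeroOfRecord F N p.K (g 0) E)
      (fun V' => ∑ s', chiSeqOfRecord F N ν M g p.K 1 s' V' *
        texpASucc (avOfRecord F N p.K 0).avg (chiSeqOfRecord F N ν M g p.K 0) (fun _ => rhoZeroOfRecord F N p.K (g 0) E)
          (fun s U V => (∏ y ∈ Y, ∏ x ∈ (block y).erase (emb y),
            (B16ZLower.zNorm (SU N) a ε₀)⁻¹ * fpIntegrand a ε₀ ((contourOfRecord F N p.K 0).holTo U y x)) * wOfRecord F N ν M A₁ ζ p g 0 s U V) s' V') := by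
  have hρ := BalabanUVNodesN11TransportFineGaugeOrbitAverage.fineGaugeInvariant_rhoZeroOfRecord F N p.K (g 0) E
  have hρi : Integrable (rhoZeroOfRecord F N p.K (g 0) E) (fieldMeasure (F.P p.K) 0 (SU N)) := by
    unfold rhoZeroOfRecord
    exact (Missing.integrable_boltzmann RegularGaugeGroup.measurable_reTr (F.P p.K) (sq_nonneg _)).const_mul _
  have hsum : (fun U => ∑ s, chiSeqOfRecord F N ν M g p.K 0 s U * rhoZeroOfRecord F N p.K (g 0) E U) = rhoZeroOfRecord F N p.K (g 0) E := by
    funext U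
    rw [Seq.sum_seq_zero, chiSeqOfRecord_zero, one_mul]
  have h := isRT_sum_tstep_fpWeight_mul_wOfRecord F N ν M A₁ hζ hζ' p g hK ha hε Y (fun _ => rhoZeroOfRecord F N p.K (g 0) E)
    (fun s => by simp only [chiSeqOfRecord_zero, one_mul]; exact hρi) (by rw [hsum]; exact hρ) hw hχ
  rw [hsum] at h
  exact h

end Record

end Summit.QuantumFields.YangMills.Theorems.BalabanUVNodesN11TStepFaddeevPopovWeightSum

end
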